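import Summits.AnomalousDissipation.AnomalousDissipation.Theorems.SawtoothPulseCascadeK1LocalisedCascadeBlockJunkOsc

/-!
# K1loc — helper: THE OSCILLATORY BLOCK JUNK FOR A GENERAL GROWTH RATIO OF THE BLOCK DENOMINATORS (thin geometries)

Helper file of the prover lane on the crux `K1LocalisedCascade` (stmt-AnomalousDissipation-19491), route `SawtoothPulseCascade`
(S-B/S-C assembly seat; the LEDGER ASSEMBLY, arithmetic layer; companion of `…BlockJunkOsc`).  `…BlockJunkOsc.blockJunk_osc_sum_le` sums
the per-block oscillatory junk of `…RatioBlocksOsc` / `…StripBlocksOsc` over DOUBLING blocks (`D_m ≥ D₀2^m`).  In the THIN phases of the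
ledger (threshold ratio `γ² − 3 = 61`, cone pinned at the slope `0.128`; this seat's STATUS 2026-08-28) the fibre blocks cannot double near
the floor: the strip windows (T-H)/(S-V) use an arithmetic head (`…CanonicalThinBlocks`, denominators only `≥ D₀` there) and the ratio windows
(O-V)/(C-H) use blocks of ratio `9/8` forever (`D_m ≥ D₀(9/8)^m`).  This file is the block sum for ANY ratio `ρ ≥ 1`:
* `blockJunk_osc_sum_le_geom`: with `0 ≤ r_m ≤ r*`, `1 ≤ A_m ≤ A*`, `D_m ≥ D₀ρ^m`, the canonical oscillatory depth and rounding allowances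
  `ε₀^m ≤ e₀2^{m+1} + b₀ρ^{−m}`, and `Σ_{m<M_b} ρ^{−m} ≤ S`:
  `Σ_{m<M_b}(r_m(ε₀^m + A_m√(2N·4d₀^m)))² ≤ 3r*²((4/3)(e₀2^{M_b})² + S·b₀² + S·4NA*/(πD₀) + M_b(8NA*²√(4Mδ/(πD₀)) + 8A*²Mδ/π))`;
* the three sums `S`: `sum_range_inv_pow_le_card` (`ρ ≥ 1`: `S = M_b`), `sum_range_inv_pow_le_of_lt` (`ρ > 1`: `S = ρ/(ρ−1)`), and
  `…BlockJunk.sum_range_half_pow_le` (`ρ = 2`: `S = 2`, recovering `blockJunk_osc_sum_le`).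
Pure real arithmetic; no definitions; no statement about the crux. [cite: Grafakos2014, Prop. 3.2.7 (3)] [problem: turb]
-/

-- `Summit.<Summit>.<Problem>`: single-conjunct summit, the duplicate namespace segment is deliberate.
set_option linter.dupNamespace false

noncomputable section

namespace Summit.AnomalousDissipation.AnomalousDissipation.Theorems.SawtoothPulseCascade.K1Window

open Finset Real

/-! ## §1 The geometric sums -/

/-- `Σ_{m<M} ρ^{−m} ≤ M` for `ρ ≥ 1`. [folklore] -/
theorem sum_range_inv_pow_le_card {ρ : ℝ} (hρ : 1 ≤ ρ) (M : ℕ) : ∑ m ∈ range M, (1 / ρ) ^ m ≤ M := by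
  have h1 : ∀ m ∈ range M, (1 / ρ) ^ m ≤ (1 : ℝ) := fun m _ =>
    pow_le_one₀ (by positivity) (by rw [div_le_one (by linarith)]; exact hρ)
  calc ∑ m ∈ range M, (1 / ρ) ^ m ≤ ∑ _m ∈ range M, (1 : ℝ) := sum_le_sum h1
    _ = M := by simp

/-- `Σ_{m<M} ρ^{−m} ≤ ρ/(ρ−1)` for `ρ > 1`. [folklore] -/
theorem sum_range_inv_pow_le_of_lt {ρ : ℝ} (hρ : 1 < ρ) (M : ℕ) : ∑ m ∈ range M, (1 / ρ) ^ m ≤ ρ / (ρ - 1) := by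
  have hq0 : (0 : ℝ) ≤ 1 / ρ := by positivity
  have hq1 : 1 / ρ < 1 := by rw [div_lt_one (by linarith)]; exact hρ
  have hs : Summable fun m : ℕ => (1 / ρ) ^ m := summable_geometric_of_lt_one hq0 hq1
  calc ∑ m ∈ range M, (1 / ρ) ^ m ≤ ∑' m : ℕ, (1 / ρ) ^ m := hs.sum_le_tsum (range M) fun m _ => by positivity
    _ = (1 - 1 / ρ)⁻¹ := tsum_geometric_of_lt_one hq0 hq1
    _ = ρ / (ρ - 1) := by
        have hρ0 : ρ ≠ 0 := by positivity
        have : ρ - 1 ≠ 0 := by linarith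
        field_simp

/-! ## §2 The block sum for a general growth ratio -/

/-- **THE OSCILLATORY JUNK OF A BLOCK FAMILY WITH DENOMINATORS `D_m ≥ D₀ρ^m`** (`ρ ≥ 1`; see the file header). [folklore] -/
theorem blockJunk_osc_sum_le_geom {r A D ε₀ : ℕ → ℝ} {rs As D₀ e₀ b₀ N Mδ ρ S : ℝ} (hN : 0 < N) (hMδ : 0 ≤ Mδ) (hD₀ : 0 < D₀)
    (hρ : 1 ≤ ρ) (hr0 : ∀ m, 0 ≤ r m) (hr : ∀ m, r m ≤ rs) (hA1 : ∀ m, 1 ≤ A m) (hA : ∀ m, A m ≤ As)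
    (hD : ∀ m, D₀ * ρ ^ m ≤ D m) (hε0 : ∀ m, 0 ≤ ε₀ m) (he₀ : 0 ≤ e₀) (hb₀ : 0 ≤ b₀)
    (hε : ∀ m, ε₀ m ≤ e₀ * 2 ^ (m + 1) + b₀ * (1 / ρ) ^ m) (Mb : ℕ) (hS : ∑ m ∈ range Mb, (1 / ρ) ^ m ≤ S) :
    ∑ m ∈ range Mb, (r m * (ε₀ m + A m * Real.sqrt (2 * N * (4 * (1 / (2 * π * A m * D m) +
        Real.sqrt (4 * Mδ / (π * A m * D m)) + Mδ / (π * N)))))) ^ 2 ≤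
      3 * rs ^ 2 * (4 / 3 * (e₀ * 2 ^ Mb) ^ 2 + S * b₀ ^ 2 + S * (4 * N * As / (π * D₀)) +
        Mb * (8 * N * As ^ 2 * Real.sqrt (4 * Mδ / (π * D₀)) + 8 * As ^ 2 * Mδ / π)) := by
  have hπ := Real.pi_pos
  have hA0 : ∀ m, 0 < A m := fun m => lt_of_lt_of_le one_pos (hA1 m)
  have hAs : 0 ≤ As := (hA0 0).le.trans (hA 0)
  have hrs : 0 ≤ rs := (hr0 0).trans (hr 0)
  have hq0 : (0 : ℝ) ≤ 1 / ρ := by positivity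
  have hq1 : 1 / ρ ≤ 1 := by rw [div_le_one (by linarith)]; exact hρ
  have hρm : ∀ m : ℕ, (1 : ℝ) ≤ ρ ^ m := fun m => one_le_pow₀ hρ
  set C : ℝ := 8 * N * As ^ 2 * Real.sqrt (4 * Mδ / (π * D₀)) + 8 * As ^ 2 * Mδ / π with hC
  have hC0 : 0 ≤ C := by positivity
  -- per block
  have hblock : ∀ m, (r m * (ε₀ m + A m * Real.sqrt (2 * N * (4 * (1 / (2 * π * A m * D m) +
      Real.sqrt (4 * Mδ / (π * A m * D m)) + Mδ / (π * N)))))) ^ 2 ≤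
      3 * rs ^ 2 * ((e₀ * 2 ^ (m + 1)) ^ 2 + b₀ ^ 2 * (1 / ρ) ^ m + (4 * N * As / (π * D₀) * (1 / ρ) ^ m + C)) := by
    intro m
    have hDm : 0 < D₀ * ρ ^ m := by positivity
    have hs2 := block_oscDepth_sq_le (N := N) (Mδ := Mδ) (hA1 m) (hA m) hDm (hD m) hN hMδ
    set s := A m * Real.sqrt (2 * N * (4 * (1 / (2 * π * A m * D m) + Real.sqrt (4 * Mδ / (π * A m * D m)) +
      Mδ / (π * N)))) with hs
    have hs0 : 0 ≤ s := mul_nonneg (hA0 m).le (Real.sqrt_nonneg _)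
    have hD0le : Real.sqrt (4 * Mδ / (π * (D₀ * ρ ^ m))) ≤ Real.sqrt (4 * Mδ / (π * D₀)) := by
      refine Real.sqrt_le_sqrt (div_le_div_of_nonneg_left (by positivity) (by positivity) ?_)
      have h2 := mul_le_mul_of_nonneg_left (hρm m) (by positivity : (0 : ℝ) ≤ π * D₀)
      linarith
    have hs2' : s ^ 2 ≤ 4 * N * As / (π * D₀) * (1 / ρ) ^ m + C := by
      have e1 : 4 * N * As / (π * (D₀ * ρ ^ m)) = 4 * N * As / (π * D₀) * (1 / ρ) ^ m := by
        rw [one_div_pow]; field_simp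
      have h2 : 8 * N * As ^ 2 * Real.sqrt (4 * Mδ / (π * (D₀ * ρ ^ m))) ≤ 8 * N * As ^ 2 * Real.sqrt (4 * Mδ / (π * D₀)) :=
        mul_le_mul_of_nonneg_left hD0le (by positivity)
      have h1 : 4 * N * As / (π * D m) ≤ 4 * N * As / (π * (D₀ * ρ ^ m)) :=
        div_le_div_of_nonneg_left (by positivity) (by positivity) (mul_le_mul_of_nonneg_left (hD m) hπ.le)
      rw [hC, ← e1]
      linarith
    set a₁ : ℝ := e₀ * 2 ^ (m + 1) with ha₁
    set a₂ : ℝ := b₀ * (1 / ρ) ^ m with ha₂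
    have ha₁0 : 0 ≤ a₁ := by positivity
    have ha₂0 : 0 ≤ a₂ := by positivity
    have hin : 0 ≤ ε₀ m + s := add_nonneg (hε0 m) hs0
    have hle : r m * (ε₀ m + s) ≤ rs * (a₁ + a₂ + s) := by
      calc r m * (ε₀ m + s) ≤ rs * (ε₀ m + s) := mul_le_mul_of_nonneg_right (hr m) hin
        _ ≤ rs * (a₁ + a₂ + s) := mul_le_mul_of_nonneg_left (by linarith [hε m]) hrs
    have hl0 : 0 ≤ r m * (ε₀ m + s) := mul_nonneg (hr0 m) hin
    -- `a₂² = b₀²(1/ρ)^{2m} ≤ b₀²(1/ρ)^m`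
    have ha₂sq : a₂ ^ 2 ≤ b₀ ^ 2 * (1 / ρ) ^ m := by
      rw [ha₂, mul_pow, ← pow_mul]
      refine mul_le_mul_of_nonneg_left ?_ (sq_nonneg _)
      calc (1 / ρ) ^ (m * 2) = (1 / ρ) ^ m * (1 / ρ) ^ m := by rw [mul_two, pow_add]
        _ ≤ (1 / ρ) ^ m * 1 := mul_le_mul_of_nonneg_left (pow_le_one₀ hq0 hq1) (by positivity)
        _ = (1 / ρ) ^ m := mul_one _
    calc (r m * (ε₀ m + s)) ^ 2 ≤ (rs * (a₁ + a₂ + s)) ^ 2 := pow_le_pow_left₀ hl0 hle 2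
      _ = rs ^ 2 * (a₁ + a₂ + s) ^ 2 := by ring
      _ ≤ rs ^ 2 * (3 * (a₁ ^ 2 + a₂ ^ 2 + s ^ 2)) :=
          mul_le_mul_of_nonneg_left
            (by nlinarith [sq_nonneg (a₁ - a₂), sq_nonneg (a₂ - s), sq_nonneg (a₁ - s)]) (sq_nonneg _)
      _ ≤ 3 * rs ^ 2 * (a₁ ^ 2 + b₀ ^ 2 * (1 / ρ) ^ m + (4 * N * As / (π * D₀) * (1 / ρ) ^ m + C)) := by
          have h3 : 0 ≤ 3 * rs ^ 2 := by positivity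
          nlinarith
  -- sum over the blocks
  have hS0 : 0 ≤ ∑ m ∈ range Mb, (1 / ρ : ℝ) ^ m := sum_nonneg fun m _ => by positivity
  calc ∑ m ∈ range Mb, (r m * (ε₀ m + A m * Real.sqrt (2 * N * (4 * (1 / (2 * π * A m * D m) +
        Real.sqrt (4 * Mδ / (π * A m * D m)) + Mδ / (π * N)))))) ^ 2
      ≤ ∑ m ∈ range Mb, 3 * rs ^ 2 * ((e₀ * 2 ^ (m + 1)) ^ 2 + b₀ ^ 2 * (1 / ρ) ^ m +
          (4 * N * As / (π * D₀) * (1 / ρ) ^ m + C)) := sum_le_sum fun m _ => hblock m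
    _ = 3 * rs ^ 2 * (e₀ ^ 2 * ∑ m ∈ range Mb, ((2 : ℝ) ^ (m + 1)) ^ 2 + b₀ ^ 2 * ∑ m ∈ range Mb, ((1 : ℝ) / ρ) ^ m +
          (4 * N * As / (π * D₀) * ∑ m ∈ range Mb, ((1 : ℝ) / ρ) ^ m + Mb * C)) := by
        rw [← mul_sum, sum_add_distrib, sum_add_distrib, sum_add_distrib, mul_sum, mul_sum, mul_sum, sum_const, card_range,
          nsmul_eq_mul]
        congr 1
        refine congrArg₂ _ (congrArg₂ _ (sum_congr rfl fun m _ => by ring) rfl) rfl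
    _ ≤ 3 * rs ^ 2 * (4 / 3 * (e₀ * 2 ^ Mb) ^ 2 + S * b₀ ^ 2 + S * (4 * N * As / (π * D₀)) + Mb * C) := by
        refine mul_le_mul_of_nonneg_left ?_ (by positivity)
        have hS1 : e₀ ^ 2 * ∑ m ∈ range Mb, ((2 : ℝ) ^ (m + 1)) ^ 2 ≤ 4 / 3 * (e₀ * 2 ^ Mb) ^ 2 := by
          calc e₀ ^ 2 * ∑ m ∈ range Mb, ((2 : ℝ) ^ (m + 1)) ^ 2 ≤ e₀ ^ 2 * (4 / 3 * ((2 : ℝ) ^ Mb) ^ 2) :=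
              mul_le_mul_of_nonneg_left (sum_range_sq_two_pow_succ_le Mb) (sq_nonneg _)
            _ = 4 / 3 * (e₀ * 2 ^ Mb) ^ 2 := by ring
        have hS2 : b₀ ^ 2 * ∑ m ∈ range Mb, ((1 : ℝ) / ρ) ^ m ≤ S * b₀ ^ 2 := by
          nlinarith [hS, sq_nonneg b₀]
        have hS3 : 4 * N * As / (π * D₀) * ∑ m ∈ range Mb, ((1 : ℝ) / ρ) ^ m ≤ S * (4 * N * As / (π * D₀)) := by
          have h0 : 0 ≤ 4 * N * As / (π * D₀) := by positivity
          nlinarith [hS]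
        linarith

end Summit.AnomalousDissipation.AnomalousDissipation.Theorems.SawtoothPulseCascade.K1Window
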